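import Summits.BirchSwinnertonDyer.BirchSwinnertonDyer.Theorems.GenusKolyvaginAtTwoShaCardDvdPowAtTwoRTCyclicLocalFrame
import Summits.BirchSwinnertonDyer.Rank1Residual.X11b.PropagatedUnramified
import Literature.NumberTheory.GaloisCohomology.PoitouTateFiniteUnramifiedTransport
import Literature.NumberTheory.EllipticCurves.KummerSelmerStructure
import HarnessLib

/-!
# Route `GenusKolyvaginAtTwo`, crux U_T `ShaCardDvdPowAtTwoRT` (stmt-BirchSwinnertonDyer-23658; upper half
# `#Ш(E/K)[2^∞] ∣ 2^(2M₀)`) — THE CYCLIC LOCAL FRAME ON `E[2^M]`: at a good place `v ∤ 2` whose arithmetic Frobenius acts on `E[2^M]` as a regular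
# involution and with `2^M ∣ N(v)+1`, both `H¹_ur(K_v, E[2^M])` and `H¹(K_v, E[2^M])/H¹_ur` are CYCLIC of order `2^M`

Seat `bsd-line-gk2-p3` g25 (PROVER seat 3/3, cell `bsd-f1-sign2`), `--supports stmt-BirchSwinnertonDyer-23658` (helper; closes nothing).
THEOREMS ONLY (no definition, no named fact, no `sorry`): the E-specialisation of `…RTCyclicLocalFrame` (p744516), with the curve-specific inputs
discharged from the tree — inertia-triviality of `E[2^M]` at good `v ∤ 2` (x11b `AcSelmer.restrictField_torsionGaloisModule_apply_of_mem_absInertia`,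
Néron–Ogg–Shafarevich) and `#E[2^M] = 4^M` prime to the residue characteristic (`natCard_geomTorsion`, `ringChar_residueField_not_dvd_of_not_mem`).
BSD is NOT proved by any of this; neither is U_T nor any stub.

WHY (seat memo `Cruxes/ShaCardDvdPowAtTwoRT/Lines/norm-sharp-upper-gk2p3.md` §10/§13).  The twin-descent line for U_T runs Kolyvagin's induction over
`ℚ`; at an inert Kolyvagin prime `ℓ` for `2` (`2^M ∣ ℓ+1`, `Frob_ℓ = c₀` a complex conjugation on `E[2^M]`, regular on `Δ < 0`) the local frame of
`H¹(ℚ_ℓ, E[2^M])` must be cyclic on both sides for McCallum's Lemma 5.3 to lose no bit.  This file proves exactly that for any number field `K`,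
any good `v ∤ 2`, with the action of the local arithmetic Frobenius DISPLAYED as a regular involution (`hspan`, `hfree`, `htor`, `hinv`) and the
Kolyvagin congruence `2^M ∣ N(v)+1` displayed; what remains for `K = ℚ` is to read these off `FrobEqFrobInfty W K (2^M) ℓ` +
`exists_regular_generator_of_Δ_neg` (K-side model: `torsionMap_liftAutPlace_eq_transport_conj`) and `M ≤ kolyvaginIndex W 2 ℓ`.
* **`cyclicLocalFrame_torsion_two`** — unramified side `H¹_ur = ℤ·u₀` (`a•u₀ = 0 ⟺ 2^M ∣ a`) and singular side `H¹/H¹_ur ≅ ℤ·(P₀ − φP₀)`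
  (order `2^M`) via evaluation at a tame generator.

References: [McCallumLMS1991] §4 Prop. 4.4, §5 Lemma 5.3; [Rubin2000] Lemma 1.3.2; [SilvermanAEC2009] VII Prop. 4.1; [MazurRubinMemoirs2004] Lemma 1.2.1.
-/

set_option autoImplicit false

-- the Theorems namespace of this sub repeats the summit name by design (D-0017 nested layout)
set_option linter.dupNamespace false

noncomputable section

open Function Field ValuativeRel NumberField IsDedekindDomain
open scoped Classical

namespace Summit.BirchSwinnertonDyer.BirchSwinnertonDyer.Theorems.GenusExact.PlusDescent

section Torsion

open Literature.NumberTheory.EllipticCurves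
open Literature.NumberTheory.GaloisRepresentations
open Literature.NumberTheory.GaloisRepresentations.DiscreteGaloisModule
open Literature.NumberTheory.GaloisRepresentations.IsNonarchimedeanLocalField
open Literature.NumberTheory.GaloisCohomology.PoitouTateFinite.GaloisImage.UnramifiedCup (ringChar_residueField_not_dvd_of_not_mem)
open Summit.BirchSwinnertonDyer.Rank1Residual.X11b.AcSelmer (restrictField_torsionGaloisModule_apply_of_mem_absInertia)
open WeierstrassCurve

variable {K : Type} [Field K] [NumberField K] (W : WeierstrassCurve K) [W.IsElliptic]

/-- **THE CYCLIC LOCAL FRAME ON `E[2^M]` at a good place `v ∤ 2` whose arithmetic Frobenius acts as a regular involution.**  `E/K` elliptic over a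
number field, `v ∤ 2` of good reduction (so inertia acts trivially on `E[2^M]`, `#E[2^M] = 4^M` is prime to the residue characteristic), `φ` an
arithmetic Frobenius of `K_v` acting on `E[2^M](K̄)` (through `GaloisRep.toLocal v`) as a REGULAR INVOLUTION with frame `P₀` (for `K = ℚ`, `ℓ`
inert Kolyvagin for `2` with `FrobEqFrobInfty`, `Δ < 0`: `φ` acts as a complex conjugation, regular by `exists_regular_generator_of_Δ_neg`), and
`2^M ∣ N(v) + 1` (the Kolyvagin congruence).  Then BOTH sides of the local frame of `H¹(K_v, E[2^M])` are CYCLIC of order `2^M`: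
`H¹_ur = ℤ·u₀` with `a•u₀ = 0 ⟺ 2^M ∣ a`, and `H¹/H¹_ur ≅ ℤ·(P₀ − φP₀)` via evaluation at a tame generator.  This is the local structure that
makes McCallum's Lemma 5.3 exact over `ℚ_ℓ` at `p = 2` (memo §10/§13). [cite: McCallumLMS1991, §4 Prop. 4.4, §5 Lemma 5.3]
[cite: Rubin2000, Lemma 1.3.2] [cite: SilvermanAEC2009, VII Prop. 4.1 (Néron–Ogg–Shafarevich for torsion)] -/
theorem cyclicLocalFrame_torsion_two (v : HeightOneSpectrum (𝓞 K)) (h2v : ((2 : ℕ) : 𝓞 K) ∉ v.asIdeal) (hv : W.HasGoodReductionAt v)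
    {M : ℕ} {φ : absoluteGaloisGroup (v.adicCompletion K)} (hφ : IsAbsArithFrob φ)
    (P₀ : geomTorsion W ((2 ^ M : ℕ) : ℤ))
    (hspan : ∀ Q : geomTorsion W ((2 ^ M : ℕ) : ℤ), ∃ a b : ℤ,
      Q = a • P₀ + b • GaloisRep.toLocal v (W.torsionGaloisModule ((2 ^ M : ℕ) : ℤ)) φ P₀)
    (hfree : ∀ a b : ℤ, a • P₀ + b • GaloisRep.toLocal v (W.torsionGaloisModule ((2 ^ M : ℕ) : ℤ)) φ P₀ = 0 →
      (2 ^ M : ℤ) ∣ a ∧ (2 ^ M : ℤ) ∣ b)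
    (htor : (2 ^ M : ℤ) • P₀ = 0)
    (hinv : ∀ x, GaloisRep.toLocal v (W.torsionGaloisModule ((2 ^ M : ℕ) : ℤ)) φ
      (GaloisRep.toLocal v (W.torsionGaloisModule ((2 ^ M : ℕ) : ℤ)) φ x) = x)
    (hq : 2 ^ M ∣ residueFieldCard (v.adicCompletion K) + 1) :
    (∃ unr : geomTorsion W ((2 ^ M : ℕ) : ℤ) →+ galoisCohomology (GaloisRep.toLocal v (W.torsionGaloisModule ((2 ^ M : ℕ) : ℤ))) 1,
      (∀ w, unr w ∈ DiscreteGaloisModule.unramifiedSubgroup (GaloisRep.toLocal v (W.torsionGaloisModule ((2 ^ M : ℕ) : ℤ))) 1) ∧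
      (∀ c ∈ DiscreteGaloisModule.unramifiedSubgroup (GaloisRep.toLocal v (W.torsionGaloisModule ((2 ^ M : ℕ) : ℤ))) 1,
        ∃ a : ℤ, c = a • unr P₀) ∧
      (∀ a : ℤ, a • unr P₀ = 0 ↔ (2 ^ M : ℤ) ∣ a)) ∧
    (∃ (σ₀ : absInertia (v.adicCompletion K))
        (sing : galoisCohomology (GaloisRep.toLocal v (W.torsionGaloisModule ((2 ^ M : ℕ) : ℤ))) 1 →+ geomTorsion W ((2 ^ M : ℕ) : ℤ)),
      (∀ z : contOneCocycles (GaloisRep.toLocal v (W.torsionGaloisModule ((2 ^ M : ℕ) : ℤ))).toTopRep,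
        sing (oneCocycleClass _ z) = z.1 (σ₀ : absoluteGaloisGroup (v.adicCompletion K))) ∧
      (∀ c, sing c = 0 ↔ c ∈ DiscreteGaloisModule.unramifiedSubgroup (GaloisRep.toLocal v (W.torsionGaloisModule ((2 ^ M : ℕ) : ℤ))) 1) ∧
      (∀ c, ∃ a : ℤ, sing c = a • (P₀ - GaloisRep.toLocal v (W.torsionGaloisModule ((2 ^ M : ℕ) : ℤ)) φ P₀)) ∧
      (∀ a : ℤ, ∃ c, sing c = a • (P₀ - GaloisRep.toLocal v (W.torsionGaloisModule ((2 ^ M : ℕ) : ℤ)) φ P₀)) ∧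
      addOrderOf (P₀ - GaloisRep.toLocal v (W.torsionGaloisModule ((2 ^ M : ℕ) : ℤ)) φ P₀) = 2 ^ M) := by
  haveI : Fact (Nat.Prime 2) := ⟨Nat.prime_two⟩
  set ρ := GaloisRep.toLocal v (W.torsionGaloisModule ((2 ^ M : ℕ) : ℤ)) with hρ
  have hn0 : ((2 ^ M : ℕ) : ℤ) ≠ 0 := by exact_mod_cast pow_ne_zero M two_ne_zero
  haveI : Finite (geomTorsion W ((2 ^ M : ℕ) : ℤ)) := finite_torsionPoints_holds W (AlgebraicClosure K) hn0
  -- inertia acts trivially on `E[2^M]` at the good place `v ∤ 2`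
  have htrivI : ∀ τ ∈ absInertia (v.adicCompletion K), ∀ w : geomTorsion W ((2 ^ M : ℕ) : ℤ), ρ τ w = w :=
    fun τ hτ w ↦ restrictField_torsionGaloisModule_apply_of_mem_absInertia W 2 M h2v hv hτ w
  -- `#E[2^M] = 4^M` is prime to the residue characteristic
  have h2Mv : ((2 ^ M : ℕ) : 𝓞 K) ∉ v.asIdeal := fun h ↦ by
    rw [Nat.cast_pow] at h
    exact h2v (v.isPrime.mem_of_pow_mem M h)
  have hndvd : ¬ ringChar 𝓀[v.adicCompletion K] ∣ 2 ^ M := ringChar_residueField_not_dvd_of_not_mem (2 ^ M) v h2Mv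
  have hW : (Nat.card (geomTorsion W ((2 ^ M : ℕ) : ℤ))).Coprime (ringChar 𝓀[v.adicCompletion K]) := by
    rw [WeierstrassCurve.natCard_geomTorsion W _ hn0, Int.natAbs_natCast]
    exact Nat.Coprime.pow_left 2
      ((Nat.Prime.coprime_iff_not_dvd (ringChar_residueField_prime (F := v.adicCompletion K))).mpr hndvd).symm
  have hφ1 : IsFrobPow φ 1 := IsAbsArithFrob.isFrobPow_holds hφ
  obtain ⟨unr, hmem, hgen, hord, -⟩ := unramified_cyclic_of_regular_frobenius ρ htrivI hφ1 P₀ hspan hfree htor hinv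
  exact ⟨⟨unr, hmem, hgen, hord⟩, singular_cyclic_of_regular_frobenius ρ htrivI hW hφ P₀ hspan hfree htor hinv hq⟩

end Torsion

end Summit.BirchSwinnertonDyer.BirchSwinnertonDyer.Theorems.GenusExact.PlusDescent

end
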